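import Literature.MathematicalPhysics.QuantumFieldTheory.ConformalBootstrap3D.DualFunctional
import HarnessLib

/-!
# Certificate format for the single-correlator (`⟨σσσσ⟩`) exclusion: the finite list of obligations

`DualFunctional.lean` proves `CrossingFunctional.boxExcluded_of_singleCorrelatorPoints`: a
point-evaluation functional `φ = ∑_k w_k ev_{(z_k, z̄_k)}` which is positive on the identity vector
and non-negative on `F^{σσ,σσ}_{-,Δ,ℓ}[g]` for EVERY genuine block allowed in `σ×σ` by A1/A4 excludes
the box `Q` of `(Δ_σ, Δ_ε)`. That hypothesis quantifies over a continuum of `(Δ, ℓ)`. This file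
splits it — by pure logic, PROVED — into the finitely many named obligations a certificate
checker actually verifies, following the truncation used since Rattazzi–Rychkov–Tonni–Vichi
2008, §5.5 ("to claim that indeed `Δ_min > Δ_c`, we have to check that the found `Λ` does not
violate [positivity] for `Δ, l` not included in the trial set. This will not happen for
`l ≥ l_max` and `Δ ≥ Δ_max` if we take these parameters sufficiently large and include the
asymptotics. The functional `Λ` may however become slightly negative at intermediate `Δ`"):

* `BlockPositive φ s Δ ℓ` — `φ[F^{σσ,σσ}_{-,Δ,ℓ}[g]] ≥ 0` at external dimension `Δ_σ = s` for
  every `g` with `IsConformalBlock3D 0 0 Δ ℓ g` (so block uniqueness, T1, is NOT presupposed: the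
  checker's evaluator must come with a theorem that every such `g` takes the enclosed values);
* `SingleCorrelatorObligations φ Q Δ⋆` — (O1) identity positivity on `Q`; (O2) the exchanged
  `ε` itself (`ℓ = 0`, `Δ = Δ_ε = p.2`); (O3) scalars above the gap, `3 ≤ Δ < Δ⋆`
  (A4(b): `σ, ε` the only relevant scalars); (O4) even spins `ℓ ≥ 2`, `ℓ + 1 ≤ Δ < Δ⋆`;
  (O5) the TAIL `Δ ≥ Δ⋆`, all even `ℓ` — the analytic lemma with explicit `Δ⋆` (for diagonal
  point functionals: the ratio lemma of the cell's REFEREE.md F25, uniform in `ℓ`), not a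
  computation;
* `SingleCorrelatorObligations.nonneg` / `.boxExcluded` — (O1)–(O5) ⇒ the hypothesis of
  `boxExcluded_of_singleCorrelatorPoints` ⇒ `BoxExcluded Q` (PROVED);
* `CellPositive`, `scalar_nonneg_of_table`, `spinning_nonneg_of_table` — (O3) and (O4) from a
  FINITE table of `Δ`-cells `[t_k, t_{k+1}]` per spin `ℓ < L` (`Δ⋆ ≤ L + 1` bounds the spins,
  since `Δ ≥ ℓ + 1`), each cell verified uniformly in `Δ` and in `(Δ_σ, Δ_ε) ∈ Q` (interval
  arithmetic — cells, not grid points, so nothing can "become slightly negative at intermediate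
  `Δ`"); `SingleCorrelatorObligations.of_table` assembles them (PROVED).

What this file does NOT contain: any evaluator, any value of a block, any concrete `φ`, `Q`, `Δ⋆`
or table; the tail lemma (O5) itself; anything about the mixed `σ–ε` system (whose odd sector
needs the `2×2` criterion `CrossingFunctional.evenForm_nonneg_of_det` and blocks with
`Δ₁₂ ≠ 0`) or about the Ising model on `ℤ³` (`LatticeGapNonClaim.lean`).

Sources: R. Rattazzi, V. S. Rychkov, E. Tonni, A. Vichi, JHEP 12 (2008) 031, §5.5 (trial set:
`l ≤ l_max`, `Δ ≤ Δ_max`, discretised `Δ`; asymptotics for the rest); D. Poland, S. Rychkov,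
A. Vichi, Rev. Mod. Phys. 91 (2019) 015002, §IV.A (discretisation + linear programming);
F. Kos, D. Poland, D. Simmons-Duffin, JHEP 11 (2014) 109, §3.3 eq. (3.16) (the positivity
conditions, with the assumed gaps). Mathlib: `Set.Icc`, `Nat.cast` order lemmas.
-/

namespace Literature.MathematicalPhysics.QuantumFieldTheory.ConformalBootstrap3D

open Set

/-- **Block positivity** of a linear functional `φ` on sum rule 1 (`⟨σσσσ⟩`): at external
dimension `Δ_σ = s`, `φ[F^{σσ,σσ}_{-,Δ,ℓ}[g]] = φ[((1-z)(1-z̄))^s g(z,z̄) - (z z̄)^s g(1-z,1-z̄)] ≥ 0`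
for EVERY `g` satisfying the block predicate `IsConformalBlock3D 0 0 Δ ℓ g` (Kos–Poland–
Simmons-Duffin 2014, eq. (3.16), first line, single-correlator case `α⃗ = (α¹, 0, 0, 0, 0)`).
[cite: KosPolandSimmonsduffin2014, §3.3 eq. (3.16)] -/
def BlockPositive (φ : (ℝ → ℝ → ℝ) →ₗ[ℝ] ℝ) (s Δ : ℝ) (ℓ : ℕ) : Prop :=
  ∀ g : ℝ → ℝ → ℝ, IsConformalBlock3D 0 0 Δ ℓ g → 0 ≤ φ (crossF s (-1) g)

/-- **The obligations of a single-correlator certificate** for a functional `φ`, a box `Q` of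
`(Δ_σ, Δ_ε)` and a tail threshold `Δ⋆` — the trial-set truncation of Rattazzi–Rychkov–Tonni–Vichi
2008, §5.5, with the `σ×σ` spectrum assumptions A1/A4 of the `σ–ε` system (even spins,
unitarity bounds, scalars below `3` only at `Δ_ε`): (O1) `identity_pos`; (O2) `epsilon_nonneg` —
the exchanged `ε` (`ℓ = 0`, `Δ = Δ_ε`); (O3) `scalar_nonneg` — scalars with `3 ≤ Δ < Δ⋆`;
(O4) `spinning_nonneg` — even `ℓ ≠ 0`, `ℓ + 1 ≤ Δ < Δ⋆`; (O5) `tail_nonneg` — every even `ℓ`,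
`Δ ≥ Δ⋆` (and `Δ` above the unitarity bound). (O2) is required on all of `Q` even where
`Δ_ε ≥ 3` makes it redundant with (O3); harmless. [cite: RattazziEtAl2008, §5.5] -/
structure SingleCorrelatorObligations (φ : (ℝ → ℝ → ℝ) →ₗ[ℝ] ℝ) (Q : Set (ℝ × ℝ)) (Δstar : ℝ) :
    Prop where
  /-- (O1) `φ[F^{σσ,σσ}_{-,𝟙}] > 0` for every `(Δ_σ, Δ_ε) ∈ Q`. -/
  identity_pos : ∀ p ∈ Q, 0 < φ (crossF p.1 (-1) (fun _ _ => (1 : ℝ)))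
  /-- (O2) the exchanged `ε`: `ℓ = 0`, `Δ = Δ_ε = p.2`. -/
  epsilon_nonneg : ∀ p ∈ Q, BlockPositive φ p.1 p.2 0
  /-- (O3) scalars above the gap and below the tail threshold. -/
  scalar_nonneg : ∀ p ∈ Q, ∀ Δ : ℝ, 3 ≤ Δ → Δ < Δstar → BlockPositive φ p.1 Δ 0
  /-- (O4) even non-zero spins between the unitarity bound `ℓ + 1` and the tail threshold. -/
  spinning_nonneg : ∀ p ∈ Q, ∀ ℓ : ℕ, Even ℓ → ℓ ≠ 0 → ∀ Δ : ℝ, (ℓ : ℝ) + 1 ≤ Δ → Δ < Δstar →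
    BlockPositive φ p.1 Δ ℓ
  /-- (O5) the tail: every even spin, every `Δ ≥ Δ⋆` above the unitarity bound. -/
  tail_nonneg : ∀ p ∈ Q, ∀ ℓ : ℕ, Even ℓ → ∀ Δ : ℝ, unitarityBound3D ℓ ≤ Δ → Δstar ≤ Δ →
    BlockPositive φ p.1 Δ ℓ

namespace SingleCorrelatorObligations

variable {φ : (ℝ → ℝ → ℝ) →ₗ[ℝ] ℝ} {Q : Set (ℝ × ℝ)} {Δstar : ℝ}

/-- (O2)–(O5) together are exactly the block-positivity hypothesis of
`CrossingFunctional.boxExcluded_of_singleCorrelatorPoints` (case split on `Δ < Δ⋆`, `ℓ = 0`,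
`Δ < 3`; for `ℓ ≠ 0` the unitarity bound reads `ℓ + 1 ≤ Δ`). Elementary. [folklore] -/
theorem nonneg (h : SingleCorrelatorObligations φ Q Δstar) :
    ∀ p ∈ Q, ∀ (Δ : ℝ) (ℓ : ℕ) (g : ℝ → ℝ → ℝ), Even ℓ → unitarityBound3D ℓ ≤ Δ →
      (ℓ = 0 → Δ < 3 → Δ = p.2) → IsConformalBlock3D 0 0 Δ ℓ g → 0 ≤ φ (crossF p.1 (-1) g) := by
  intro p hp Δ ℓ g hℓ hb hgap hg
  rcases lt_or_ge Δ Δstar with hlt | hge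
  · by_cases h0 : ℓ = 0
    · subst h0
      rcases lt_or_ge Δ 3 with h3 | h3
      · have hΔ : Δ = p.2 := hgap rfl h3
        subst hΔ
        exact h.epsilon_nonneg p hp g hg
      · exact h.scalar_nonneg p hp Δ h3 hlt g hg
    · have hb' : (ℓ : ℝ) + 1 ≤ Δ := by simpa [unitarityBound3D, h0] using hb
      exact h.spinning_nonneg p hp ℓ hℓ h0 Δ hb' hlt g hg
  · exact h.tail_nonneg p hp ℓ hℓ Δ hb hge g hg

/-- **A discharged obligation list is a certificate.** For a point-evaluation functional with
nodes in the open square, (O1)–(O5) on `Q` give `BoxExcluded Q` (through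
`CrossingFunctional.boxExcluded_of_singleCorrelatorPoints`, whose termwise action is proved).
[cite: KosPolandSimmonsduffin2014, §3.3 eq. (3.16)] -/
theorem boxExcluded {n : ℕ} {w z zb : Fin n → ℝ} (hz : ∀ k, z k ∈ Ioo (0 : ℝ) 1)
    (hzb : ∀ k, zb k ∈ Ioo (0 : ℝ) 1)
    (h : SingleCorrelatorObligations (pointFunctional w z zb) Q Δstar) : BoxExcluded Q :=
  CrossingFunctional.boxExcluded_of_singleCorrelatorPoints w z zb hz hzb Q h.identity_pos h.nonneg

end SingleCorrelatorObligations

/-! ### The finite cell table for (O3) and (O4) -/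

/-- **Cell positivity**: `φ` is block-positive at spin `ℓ` uniformly for `Δ` in the cell `[a, b]`
and `(Δ_σ, Δ_ε) ∈ Q` — one line of a certificate table, verified by interval arithmetic on the
cell (not at grid points). [cite: RattazziEtAl2008, §5.5] -/
def CellPositive (φ : (ℝ → ℝ → ℝ) →ₗ[ℝ] ℝ) (Q : Set (ℝ × ℝ)) (ℓ : ℕ) (a b : ℝ) : Prop :=
  ∀ p ∈ Q, ∀ Δ ∈ Icc a b, BlockPositive φ p.1 Δ ℓ

/-- (O3) from a scalar cell table `3 ≥ t₀ ≤ t₁ ≤ … ≤ t_K ≥ Δ⋆` (monotonicity is not even needed: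
`exists_step_of_mem_Icc` finds a cell around any `Δ ∈ [t₀, t_K]`). Elementary. [folklore] -/
theorem scalar_nonneg_of_table {φ : (ℝ → ℝ → ℝ) →ₗ[ℝ] ℝ} {Q : Set (ℝ × ℝ)} {Δstar : ℝ}
    (t : ℕ → ℝ) {K : ℕ} (hK : 1 ≤ K) (h0 : t 0 ≤ 3) (hK' : Δstar ≤ t K)
    (hcell : ∀ k < K, CellPositive φ Q 0 (t k) (t (k + 1))) :
    ∀ p ∈ Q, ∀ Δ : ℝ, 3 ≤ Δ → Δ < Δstar → BlockPositive φ p.1 Δ 0 := by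
  intro p hp Δ h3 hlt
  obtain ⟨k, hk, hk1, hk2⟩ := exists_step_of_mem_Icc t hK (h0.trans h3) (hlt.le.trans hK')
  exact hcell k hk p hp Δ ⟨hk1, hk2⟩

/-- (O4) from a spinning cell table: spins are bounded by `L` with `Δ⋆ ≤ L + 1` (because
`Δ ≥ ℓ + 1`), and for each even `0 < ℓ < L` a row `ℓ + 1 ≥ t_{ℓ,0}, …, t_{ℓ,K_ℓ} ≥ Δ⋆` of cells.
Elementary. [folklore] -/
theorem spinning_nonneg_of_table {φ : (ℝ → ℝ → ℝ) →ₗ[ℝ] ℝ} {Q : Set (ℝ × ℝ)} {Δstar : ℝ}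
    (L : ℕ) (hL : Δstar ≤ (L : ℝ) + 1) (t : ℕ → ℕ → ℝ) (K : ℕ → ℕ) (hK : ∀ ℓ < L, 1 ≤ K ℓ)
    (h0 : ∀ ℓ < L, t ℓ 0 ≤ (ℓ : ℝ) + 1) (hK' : ∀ ℓ < L, Δstar ≤ t ℓ (K ℓ))
    (hcell : ∀ ℓ < L, Even ℓ → ℓ ≠ 0 → ∀ k < K ℓ, CellPositive φ Q ℓ (t ℓ k) (t ℓ (k + 1))) :
    ∀ p ∈ Q, ∀ ℓ : ℕ, Even ℓ → ℓ ≠ 0 → ∀ Δ : ℝ, (ℓ : ℝ) + 1 ≤ Δ → Δ < Δstar →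
      BlockPositive φ p.1 Δ ℓ := by
  intro p hp ℓ hℓ h0ℓ Δ hb hlt
  have hℓL : ℓ < L := by
    have h' : (ℓ : ℝ) < (L : ℝ) := by linarith [hlt.trans_le hL]
    exact_mod_cast h'
  obtain ⟨k, hk, hk1, hk2⟩ :=
    exists_step_of_mem_Icc (t ℓ) (hK ℓ hℓL) ((h0 ℓ hℓL).trans hb) (hlt.le.trans (hK' ℓ hℓL))
  exact hcell ℓ hℓL hℓ h0ℓ k hk p hp Δ ⟨hk1, hk2⟩

/-- **Assembly of the obligations from a finite table** (the shape of a certificate file):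
(O1), (O2), the tail lemma (O5) with threshold `Δ⋆ ≤ L + 1`, a scalar cell row and one cell row
per even spin `0 < ℓ < L`. Elementary. [cite: RattazziEtAl2008, §5.5] -/
theorem SingleCorrelatorObligations.of_table {φ : (ℝ → ℝ → ℝ) →ₗ[ℝ] ℝ} {Q : Set (ℝ × ℝ)}
    {Δstar : ℝ} (L : ℕ) (hL : Δstar ≤ (L : ℝ) + 1)
    (hI : ∀ p ∈ Q, 0 < φ (crossF p.1 (-1) (fun _ _ => (1 : ℝ))))
    (hε : ∀ p ∈ Q, BlockPositive φ p.1 p.2 0)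
    (htail : ∀ p ∈ Q, ∀ ℓ : ℕ, Even ℓ → ∀ Δ : ℝ, unitarityBound3D ℓ ≤ Δ → Δstar ≤ Δ →
      BlockPositive φ p.1 Δ ℓ)
    (t₀ : ℕ → ℝ) {K₀ : ℕ} (hK₀ : 1 ≤ K₀) (ht₀ : t₀ 0 ≤ 3) (ht₀' : Δstar ≤ t₀ K₀)
    (hcell₀ : ∀ k < K₀, CellPositive φ Q 0 (t₀ k) (t₀ (k + 1)))
    (t : ℕ → ℕ → ℝ) (K : ℕ → ℕ) (hK : ∀ ℓ < L, 1 ≤ K ℓ) (ht : ∀ ℓ < L, t ℓ 0 ≤ (ℓ : ℝ) + 1)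
    (ht' : ∀ ℓ < L, Δstar ≤ t ℓ (K ℓ))
    (hcell : ∀ ℓ < L, Even ℓ → ℓ ≠ 0 → ∀ k < K ℓ, CellPositive φ Q ℓ (t ℓ k) (t ℓ (k + 1))) :
    SingleCorrelatorObligations φ Q Δstar where
  identity_pos := hI
  epsilon_nonneg := hε
  scalar_nonneg := scalar_nonneg_of_table t₀ hK₀ ht₀ ht₀' hcell₀
  spinning_nonneg := spinning_nonneg_of_table L hL t K hK ht ht' hcell
  tail_nonneg := htail

end Literature.MathematicalPhysics.QuantumFieldTheory.ConformalBootstrap3D
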